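/-
Copyright (c) 2026. All rights reserved.
Released under Apache 2.0 license as described in the file LICENSE.
Authors: abc-iut cell, campaign-S prover seat abc-iut-S6 (wave 2).
-/
import Literature.IUT.LogVolume.TensorPacketLemmas
import Literature.IUT.LogVolume.LogRadius
import Literature.IUT.LogVolume.IntegerRingFinite
import HarnessLib

/-!
# Tensor packets: transport of [IUTchIV] Prop. 1.2 (i) and of Prop. 1.1 to the packet `V = ⊗ k_i`

Mochizuki, *Inter-universal Teichmüller theory IV*, RIMS manuscript (Apr. 2020), §1, Prop. 1.2,
kurims pp. 10–11.  The single-field inputs of the proof of Prop. 1.2 (ii)–(iv) on p. 11, made available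
on the tensor packet (PROOF-SIDE toolkit over abc-iut-S1's typed `TensorPacketRing.lean`,
`LogRadius.lean` — `prop12i_holds` — and `IntegerRing*.lean`; everything proved, nothing re-typed):

* realising the exponents by ELEMENTS: `a_i, b_i ∈ (1/e_i)ℤ` (`exists_logRadiusA_eq_div`,
  `exists_logRadiusB_eq_div`), elements of norm `p^{−a_i}`, `p^{b_i}` (`exists_norm_eq_rpow_neg_logRadiusA`,
  `exists_realizesNegB`), generators `δ_i` of the different with `‖δ_i‖ = p^{−d_i}`
  (`norm_generator_different`), and the products `∏‖h_i‖ = p^{b_I}`, `∏‖δ_i⁻¹‖ = p^{d_I}`;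
* **Prop. 1.2 (i) transported** ("we apply assertion (i)", p. 11): `(⊗α_i)·R_I ⊆ log_p(R_I^×)` for
  `‖α_i‖ ≤ p^{−a_i}` (`purePacket_mul_mem_logPacket`) and `log_p(R_I^×) ⊆ (⊗h_i)·R_I` for
  `‖h_i‖ = p^{b_i}` (`exists_mem_integerPacket_of_mem_logPacket`), hence
  `p^n·log_p(R_I^×) ⊆ p^n·(⊗h_i)·(R_I)^∼` (`ppow_smul_logPacket_subset`);
* **Prop. 1.1 in the all-`δ` form** `(⊗_{i∈I}δ_i)·(R_I)^∼ ⊆ R_I` ("`p^{d_I}·(R_I)^∼ ⊆ R_I`", the form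
  used on p. 11) derived from the typed statement `Prop11 p k` (which has `δ_* = 1`):
  `purePacket_generators_mul_mem_integerPacket`;
* `φ(p^n·T) = p^n·φ(T)` for `ℚ_p`-linear `φ`; "`a_I = −b_I`" under `p > 2`, `e_i ≤ p−2` (`bSum_eq_neg_aSum`).

Classical; the [IUTchIV] locators record where the cell uses it.  No definitions of mathematical
objects, no named facts.
-/

noncomputable section

open Metric Set IsLocalRing
open scoped Pointwise TensorProduct NormedField

namespace Literature.IUT.LogVolume

variable (p : ℕ) [Fact p.Prime]

/-! ## One field: realising the exponents `a`, `b`, `d` by elements -/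

section OneField

variable (K : Type*) [NontriviallyNormedField K] [instK : NormedAlgebra ℚ_[p] K] [IsUltrametricDist K]
  [ProperSpace K]

omit [Fact p.Prime] instK [IsUltrametricDist K] [ProperSpace K] in
/-- `a ∈ (1/e)·ℤ`: `a = N/e` with `N = 2e` (`p = 2`) or `N = ⌈e/(p−2)⌉` (`p > 2`).
[claim: Mochizuki2012, status: disputed] -/
theorem exists_logRadiusA_eq_div {e : ℕ} (he : 0 < e) : ∃ N : ℤ, logRadiusA p e = N / e := by
  unfold logRadiusA
  split_ifs with h
  · refine ⟨2 * e, ?_⟩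
    have he' : (e : ℝ) ≠ 0 := by exact_mod_cast he.ne'
    push_cast
    field_simp
  · exact ⟨_, rfl⟩

omit [Fact p.Prime] instK [IsUltrametricDist K] [ProperSpace K] in
/-- `b ∈ (1/e)·ℤ`: `b = (e·⌊log(pe/(p−1))/log p⌋ − 1)/e`. [claim: Mochizuki2012, status: disputed] -/
theorem exists_logRadiusB_eq_div {e : ℕ} (he : 0 < e) : ∃ N : ℤ, logRadiusB p e = N / e := by
  refine ⟨⌊Real.log ((p : ℝ) * e / ((p : ℝ) - 1)) / Real.log p⌋ * e - 1, ?_⟩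
  have he' : (e : ℝ) ≠ 0 := by exact_mod_cast he.ne'
  unfold logRadiusB
  push_cast
  field_simp

/-- An element `α ∈ k` with `ord(α) = a`, i.e. `‖α‖ = p^{−a}` ("`p^{a_i}`", [IUTchIV] Prop. 1.2 p. 10).
[claim: Mochizuki2012, status: disputed] -/
theorem exists_norm_eq_rpow_neg_logRadiusA :
    ∃ α : K, α ≠ 0 ∧ ‖α‖ = (p : ℝ) ^ (-logRadiusA p (absRamificationIdx p K)) := by
  obtain ⟨N, hN⟩ := exists_logRadiusA_eq_div p (absRamificationIdx_pos p K)
  obtain ⟨g, hg⟩ := exists_norm_eq_rpow_neg p K N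
  exact ⟨g, g.ne_zero, by rw [hg, hN]⟩

/-- An element `h ∈ k` with `ord(h) = −b`, i.e. `‖h‖ = p^{b}` ("`p^{−b_i}`", [IUTchIV] Prop. 1.2 p. 10).
[claim: Mochizuki2012, status: disputed] -/
theorem exists_norm_eq_rpow_logRadiusB :
    ∃ h : K, ‖h‖ = (p : ℝ) ^ logRadiusB p (absRamificationIdx p K) := by
  obtain ⟨N, hN⟩ := exists_logRadiusB_eq_div p (absRamificationIdx_pos p K)
  obtain ⟨g, hg⟩ := exists_norm_eq_rpow_neg p K (-N)
  refine ⟨g, ?_⟩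
  rw [hg, hN]
  congr 1
  push_cast
  ring

omit [Fact p.Prime] instK [ProperSpace K] in
/-- A nonzero integer is nonzero in `k`. [claim: Mochizuki2012, status: disputed] -/
theorem coe_ne_zero_of_ne_zero {g : Valued.integer K} (hg : g ≠ 0) : (g : K) ≠ 0 := by
  intro h
  apply hg
  ext
  simpa using h

/-- A generator `δ` of the different is nonzero in `k` and has `‖δ‖ = p^{−d}` ("`p^{d_i}`").
[claim: Mochizuki2012, status: disputed] -/
theorem norm_generator_different {δ : Valued.integer K} (hδ : different p K = Ideal.span {δ}) :
    (δ : K) ≠ 0 ∧ ‖(δ : K)‖ = (p : ℝ) ^ (-differentOrd p K) :=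
  ⟨coe_ne_zero_of_ne_zero K (generator_ne_zero p K hδ),
    norm_eq_rpow_neg_differentOrd p K hδ (generator_ne_zero p K hδ)⟩

end OneField

variable {I : Type}
variable (k : I → Type) [∀ i, NontriviallyNormedField (k i)] [∀ i, NormedAlgebra ℚ_[p] (k i)]
  [∀ i, IsUltrametricDist (k i)] [∀ i, ProperSpace (k i)]

omit [∀ i, NormedAlgebra ℚ_[p] (k i)] [∀ i, IsUltrametricDist (k i)] [∀ i, ProperSpace (k i)] in
/-- `∏_i ‖c_i‖ = p^{−Σ f_i}` when `‖c_i‖ = p^{−f_i}`. [claim: Mochizuki2012, status: disputed] -/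
theorem prod_norm_eq_rpow_neg_sum [Fintype I] {c : Π i, k i} {f : I → ℝ}
    (h : ∀ i, ‖c i‖ = (p : ℝ) ^ (-f i)) :
    ∏ i, ‖c i‖ = (p : ℝ) ^ (-∑ i, f i) := by
  have hp0 : (0 : ℝ) < p := by exact_mod_cast (Fact.out : p.Prime).pos
  rw [← Finset.sum_neg_distrib, Real.rpow_sum_of_pos hp0]
  exact Finset.prod_congr rfl fun i _ ↦ h i

/-- There is a family `h` realising `p^{−b_I}` (`‖h_i‖ = p^{b_i}`). [claim: Mochizuki2012, status: disputed] -/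
theorem exists_realizesNegB : ∃ h : Π i, k i, RealizesNegB p k h := by
  choose h hh using fun i ↦ exists_norm_eq_rpow_logRadiusB p (k i)
  exact ⟨h, hh⟩

/-- A family realising `p^{−b_I}` has `∏ ‖h_i‖ = p^{b_I}`. [claim: Mochizuki2012, status: disputed] -/
theorem prod_norm_of_realizesNegB [Fintype I] {h : Π i, k i} (hh : RealizesNegB p k h) :
    ∏ i, ‖h i‖ = (p : ℝ) ^ bSum p k := by
  have := prod_norm_eq_rpow_neg_sum p k (c := h)
    (f := fun i ↦ -logRadiusB p (absRamificationIdx p (k i))) (fun i ↦ by rw [neg_neg]; exact hh i)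
  rw [this, Finset.sum_neg_distrib, neg_neg]
  rfl

/-- The components of a family realising `p^{−b_I}` are nonzero. [claim: Mochizuki2012, status: disputed] -/
theorem ne_zero_of_realizesNegB {h : Π i, k i} (hh : RealizesNegB p k h) (i : I) : h i ≠ 0 := by
  have hp0 : (0 : ℝ) < p := by exact_mod_cast (Fact.out : p.Prime).pos
  exact norm_pos_iff.mp (by rw [hh i]; positivity)

/-! ## Transport of Prop. 1.2 (i) to packets -/

/-- **`⊗_i p^{a_i}·R_i ⊆ log_p(R_I^×)`** ([IUTchIV] p. 11, third inclusion, from Prop. 1.2 (i)): for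
`‖α_i‖ ≤ p^{−a_i}` and `r ∈ R_I`, `(⊗α_i)·r ∈ log_p(R_I^×)` (on pure tensors of integers
`(⊗α_i)(⊗x_i) = ⊗(α_i x_i)` with `α_i x_i ∈ p^{a_i}R_i ⊆ log_p(R_i^×)`; then additivity, `R_I` being the
additive group generated by them). [claim: Mochizuki2012, status: disputed] -/
theorem purePacket_mul_mem_logPacket {α : Π i, k i}
    (hα : ∀ i, ‖α i‖ ≤ (p : ℝ) ^ (-logRadiusA p (absRamificationIdx p (k i))))
    {r : PacketAlgebra p k} (hr : r ∈ integerPacket p k) :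
    purePacket p k α * r ∈ logPacket p k := by
  refine integerPacket_induction p k (C := fun t ↦ purePacket p k α * t ∈ logPacket p k)
    ?_ ?_ ?_ ?_ hr
  · intro x hx
    rw [purePacket_mul]
    refine AddSubgroup.subset_closure ⟨α * x, fun i ↦ ?_, rfl⟩
    refine (prop12i_holds p (k i)).1 ?_
    rw [mem_pBall_iff, Pi.mul_apply, norm_mul]
    calc ‖α i‖ * ‖x i‖ ≤ ‖α i‖ * 1 := by gcongr; exact hx i
      _ ≤ (p : ℝ) ^ (-logRadiusA p (absRamificationIdx p (k i))) := by rw [mul_one]; exact hα i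
  · rw [mul_zero]; exact zero_mem _
  · intro a b ha hb; rw [mul_add]; exact add_mem ha hb
  · intro a ha; rw [mul_neg]; exact neg_mem ha

/-- **`log_p(R_I^×) ⊆ (⊗h_i)·R_I` for `ord(h_i) = −b_i`** ([IUTchIV] p. 11, fourth inclusion, from
Prop. 1.2 (i) `log_p(R_i^×) ⊆ p^{−b_i}R_i`): every `w ∈ log_p(R_I^×)` is `(⊗h_i)·y` with `y ∈ R_I`.
[claim: Mochizuki2012, status: disputed] -/
theorem exists_mem_integerPacket_of_mem_logPacket {h : Π i, k i} (hh : RealizesNegB p k h)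
    {w : PacketAlgebra p k} (hw : w ∈ logPacket p k) :
    ∃ y ∈ integerPacket p k, w = purePacket p k h * y := by
  have hh0 := ne_zero_of_realizesNegB p k hh
  revert w
  intro w hw
  induction hw using AddSubgroup.closure_induction with
  | mem t ht =>
    obtain ⟨z, hz, rfl⟩ := ht
    refine ⟨purePacket p k (fun i ↦ z i / h i), purePacket_mem_integerPacket p k fun i ↦ ?_, ?_⟩
    · rw [norm_div, div_le_one (norm_pos_iff.mpr (hh0 i)), hh i]
      have := (prop12i_holds p (k i)).2 (hz i)
      rw [mem_pBall_iff, neg_neg] at this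
      exact this
    · rw [purePacket_mul]
      congr 1
      funext i
      exact (by rw [Pi.mul_apply, mul_comm, div_mul_cancel₀ _ (hh0 i)] :
        (h * fun i ↦ z i / h i) i = z i).symm
  | zero => exact ⟨0, zero_mem _, by rw [mul_zero]⟩
  | add a b _ _ ha hb =>
    obtain ⟨y, hy, rfl⟩ := ha
    obtain ⟨y', hy', rfl⟩ := hb
    exact ⟨y + y', add_mem hy hy', by rw [mul_add]⟩
  | neg a _ ha =>
    obtain ⟨y, hy, rfl⟩ := ha
    exact ⟨-y, neg_mem hy, by rw [mul_neg]⟩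

/-! ## Prop. 1.1 in the all-`δ` form used on p. 11 -/

variable [Fintype I] [DecidableEq I]

/-- From `Prop11` (stated with `δ_* = 1`): for generators `δ_i` of ALL the differents and
`x ∈ (R_I)^∼`, `(⊗_i δ_i)·x ∈ R_I` — the form "`p^{d_I}·(R_I)^∼ ⊆ R_I`" used in the proof of Prop. 1.2
(p. 11), since `⊗_i δ_i = ι_*(δ_*)·(⊗_{i≠*}δ_i ⊗ 1)` with `ι_*(δ_*) ∈ R_I`. [claim: Mochizuki2012, status: disputed] -/
theorem purePacket_generators_mul_mem_integerPacket (h11 : Prop11 p k) (hI : 2 ≤ Fintype.card I)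
    {δ : Π i, Valued.integer (k i)} (hδ : ∀ i, different p (k i) = Ideal.span {δ i})
    {x : PacketAlgebra p k} (hx : x ∈ normalizedPacket p k) :
    purePacket p k (fun i ↦ (δ i : k i)) * x ∈ integerPacket p k := by
  have hne : Nonempty I := Fintype.card_pos_iff.mp (by omega)
  obtain ⟨star⟩ := hne
  let δ' : Π i, Valued.integer (k i) := Function.update δ star 1
  have hδ' : ∀ i, i ≠ star → different p (k i) = Ideal.span {δ' i} := fun i hi ↦ by
    rw [show δ' i = δ i from Function.update_of_ne hi _ _]
    exact hδ i
  have h1 := (h11 hI star δ' hδ' (Function.update_self star 1 δ)).1 x hx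
  have hsplit : purePacket p k (fun i ↦ (δ i : k i)) =
      iota p k star (δ star : k star) * purePacket p k (fun i ↦ (δ' i : k i)) := by
    rw [iota_eq_purePacket, purePacket_mul]
    congr 1
    funext i
    by_cases hi : i = star
    · subst hi
      rw [Pi.mul_apply, Pi.mulSingle_eq_same, show δ' i = 1 from Function.update_self i 1 δ,
        OneMemClass.coe_one, mul_one]
    · rw [Pi.mul_apply, Pi.mulSingle_eq_of_ne hi, one_mul,
        show δ' i = δ i from Function.update_of_ne hi _ _]
  rw [hsplit, mul_assoc]
  refine mul_mem ?_ h1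
  rw [iota_eq_purePacket]
  refine purePacket_mem_integerPacket p k fun i ↦ ?_
  by_cases hi : i = star
  · subst hi; rw [Pi.mulSingle_eq_same]; exact Valued.integer.norm_le_one _
  · rw [Pi.mulSingle_eq_of_ne hi, norm_one]

omit [Fintype I] [DecidableEq I] in
/-- **The last link of the chain on p. 11**: `p^n·log_p(R_I^×) ⊆ p^n·(⊗h_i)·(R_I)^∼` for any
realisation `h` of `p^{−b_I}` (Prop. 1.2 (i) and `R_I ⊆ (R_I)^∼`). [claim: Mochizuki2012, status: disputed] -/
theorem ppow_smul_logPacket_subset {h : Π i, k i} (hh : RealizesNegB p k h) (n : ℤ) :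
    ppow p k n • (logPacket p k : Set (PacketAlgebra p k)) ⊆
      (ppow p k n * purePacket p k h) • (normalizedPacket p k : Set (PacketAlgebra p k)) := by
  rintro _ ⟨w, hw, rfl⟩
  obtain ⟨y, hy, rfl⟩ := exists_mem_integerPacket_of_mem_logPacket p k hh hw
  exact ⟨y, integerPacket_le_normalizedPacket p k hy, by simp only [smul_eq_mul]; ring⟩

omit [Fintype I] [DecidableEq I] [∀ i, IsUltrametricDist (k i)] [∀ i, ProperSpace (k i)] in
/-- A `ℚ_p`-linear `φ` commutes with `p^n·(−)` on subsets: `φ(p^n·T) = p^n·φ(T)` ("`φ` induces an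
automorphism of the submodule", p. 10). [claim: Mochizuki2012, status: disputed] -/
theorem image_ppow_smul (φ : PacketAlgebra p k ≃ₗ[ℚ_[p]] PacketAlgebra p k) (n : ℤ)
    (T : Set (PacketAlgebra p k)) : φ '' (ppow p k n • T) = ppow p k n • (φ '' T) := by
  ext v
  constructor
  · rintro ⟨_, ⟨t, ht, rfl⟩, rfl⟩
    exact ⟨φ t, ⟨t, ht, rfl⟩, by simp only [smul_eq_mul, ppow_mul_eq_smul, map_smul]⟩
  · rintro ⟨_, ⟨t, ht, rfl⟩, rfl⟩
    exact ⟨ppow p k n • t, ⟨t, ht, rfl⟩, by simp only [smul_eq_mul, ppow_mul_eq_smul, map_smul]⟩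

/-! ## Exponent arithmetic for Prop. 1.2 (iii) -/

omit [DecidableEq I] in
/-- "if `p > 2` and `e_i ≤ p−2` for all `i ∈ I`, then we have `a_I = −b_I`" (p. 11).
[claim: Mochizuki2012, status: disputed] -/
theorem bSum_eq_neg_aSum (hp : 2 < p) (he : ∀ i, absRamificationIdx p (k i) ≤ p - 2) :
    bSum p k = -aSum p k := by
  simp only [bSum, aSum, ← Finset.sum_neg_distrib]
  refine Finset.sum_congr rfl fun i _ ↦ ?_
  rw [logRadiusA_eq hp (absRamificationIdx_pos p (k i)) (he i),
    logRadiusB_eq hp (absRamificationIdx_pos p (k i)) (he i)]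

omit [∀ i, NormedAlgebra ℚ_[p] (k i)] [∀ i, IsUltrametricDist (k i)] [∀ i, ProperSpace (k i)] in
/-- `∏_j ‖(g at slot i) _j‖ = ‖g‖`. [claim: Mochizuki2012, status: disputed] -/
theorem prod_norm_mulSingle (i : I) (g : k i) :
    ∏ j, ‖Pi.mulSingle (M := fun j ↦ k j) i g j‖ = ‖g‖ := by
  rw [Finset.prod_eq_single i (fun j _ hj ↦ by rw [Pi.mulSingle_eq_of_ne hj, norm_one])
    (fun hi ↦ absurd (Finset.mem_univ i) hi), Pi.mulSingle_eq_same]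

omit [Fintype I] [∀ i, NormedAlgebra ℚ_[p] (k i)] [∀ i, IsUltrametricDist (k i)]
  [∀ i, ProperSpace (k i)] in
/-- The components of `g` at slot `i` are nonzero when `g ≠ 0`. [claim: Mochizuki2012, status: disputed] -/
theorem mulSingle_ne_zero {i : I} {g : k i} (hg : g ≠ 0) (j : I) :
    Pi.mulSingle (M := fun j ↦ k j) i g j ≠ 0 := by
  by_cases hj : j = i
  · subst hj; rwa [Pi.mulSingle_eq_same]
  · rw [Pi.mulSingle_eq_of_ne hj]; exact one_ne_zero

omit [DecidableEq I] in
/-- `∏_j ‖δ_j⁻¹‖ = p^{d_I}` for generators `δ_j` of the differents. [claim: Mochizuki2012, status: disputed] -/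
theorem prod_norm_inv_generators {δ : Π j, Valued.integer (k j)}
    (hδ : ∀ j, different p (k j) = Ideal.span {δ j}) :
    ∏ j, ‖((δ j : k j))⁻¹‖ = (p : ℝ) ^ dSum p k := by
  have hp0 : (0 : ℝ) < p := by exact_mod_cast (Fact.out : p.Prime).pos
  have hδn : ∀ j, ‖(δ j : k j)‖ = (p : ℝ) ^ (-differentOrd p (k j)) := fun j ↦
    (norm_generator_different p (k j) (hδ j)).2
  simp_rw [norm_inv, Finset.prod_inv_distrib]
  rw [prod_norm_eq_rpow_neg_sum p k hδn, Real.rpow_neg hp0.le, inv_inv]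
  rfl

end Literature.IUT.LogVolume

end
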